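import Mathlib.Analysis.Calculus.Gradient.Basic
import Mathlib.Analysis.Calculus.ContDiff.Defs
import Mathlib.Analysis.InnerProductSpace.PiL2
import Mathlib.MeasureTheory.Integral.Bochner.Basic
import Mathlib.MeasureTheory.Measure.Haar.InnerProductSpace
import Mathlib.Topology.MetricSpace.Lipschitz
import HarnessLib

/-!
# Propagation of positivity for Lipschitz supersolutions of `∂ₜV − ΔV + b·∇V = 0` with a bounded divergence-free drift
# (Nazarov–Ural'tseva 2011, Cor. 3.2–3.3 / Lemma 3.4; as stated by Lei–Ren–Tian 2025, Lemma 2.5) — named fact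

Topic `Literature/Analysis/FluidPDE` (family `ns`). Requested by route `AxisTwistDoor` of `NavierStokesRegularity`
(crux `AveragedConeLiouville`, planned stub `coneLiouvilleGivenSwirl`: De Giorgi–Nash–Moser decay of the circle-averaged vorticity
flux `Γ` at the axis, applied — as in Lei–Ren–Tian §4 — to the axisymmetric `V = sup Γ − Γ` on `B(1) ⊂ ℝ³`).

## Source, as printed

* **Lei–Ren–Tian, arXiv:2501.08976, Lemma 2.5 (p. 7)**: "Suppose `V(x,t)` is a nonnegative Lipshitz supersolution in `B(1) × (0,T)`
  to the equation `∂ₜV − ΔV + b·∇V = 0` where the drift `b ∈ L^∞(B(1) × (0,T))` and `∇·b = 0`. Assume that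
  `meas({x ∈ B(1) : V(x, t̄) ≥ λ}) ≥ δ` for some `t̄ ∈ (0, T/3)`, `λ > 0` and `δ > 0`, then given any `0 < r < 1` there exists a constant
  `β = β(δ, T, r, ‖b‖_{L^∞(B(1)×(0,T))}) > 0` such that `V ≥ βλ` in `B(r) × (T/2, T)`." — "The exact choice of domains … can be rather
  arbitrary, as long as the relation `t̄ < T/2` is respected. For the proof of this lemma, we refer to [NU]."
* **Nazarov–Ural'tseva, Algebra i Analiz 23 (2011) = St. Petersburg Math. J. 23 (2012) 93–115, arXiv:1011.1888**, §3 (parabolic operators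
  `𝓜u = ∂ₜu − Dᵢ(aᵢⱼDⱼu) + bᵢDᵢu` (DP), uniformly parabolic, `div b ≤ 0` in the sense of distributions, `b ∈ L_{q,ℓ}` with
  `n/q + 2/ℓ ≤ 1` — every bounded `b` on a bounded cylinder qualifies): Corollary 3.2 (p. 10: a Lipschitz nonnegative supersolution with
  `meas({V(·,t̄) ≥ k} ∩ B_R) ≥ δ meas(B_R)` satisfies `V ≥ β₁k` on a later cylinder, `β₁ = β₁(δ, n, ν, q, ℓ, 𝓝̂)`), Lemma 3.4 (propagation
  forward in time, `β₂` determined by `Θ, n, ν, q, ℓ, 𝓝̂`) and Corollary 3.3 (`V ≥ β₃k` in `Q_{R/2}`). Supersolutions are LIPSCHITZ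
  GENERALIZED supersolutions (p. 2–3, p. 8): `V` Lipschitz on the cylinder and `∫∫ (∂ₜV·η + aᵢⱼDⱼV Dᵢη + bᵢDᵢV·η) dx dt ≥ 0` for every
  nonnegative Lipschitz test function `η` vanishing in a neighbourhood of the parabolic boundary.

## Lean rendering

The space is a finite-dimensional real inner product space `E` (`n = finrank E ≥ 2`, as in the source's standing notation) with its
Lebesgue measure; functions are written `V : ℝ → E → ℝ`, `b : ℝ → E → E` (time first, as in `ParabolicLocalEstimates`). The drift is
jointly measurable, bounded by `A` POINTWISE on the cylinder (stronger than `L^∞`, hence a weaker fact) and divergence-free in the sense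
of distributions on the cylinder (`∫∫ ⟪b, ∇ₓφ⟫ = 0` for smooth `φ` compactly supported in the open cylinder). `V` is Lipschitz on the
open cylinder `(0,T) × B(1)`, nonnegative there, and a generalized supersolution against EVERY nonnegative Lipschitz `η : ℝ → E → ℝ`
vanishing near the lateral boundary and near the bottom (`η(t,x) = 0` whenever `‖x‖ ≥ ρ` or `t ≤ τ`, some `ρ < 1`, `τ > 0`) — the largest
printed test class, so the rendering does not strengthen the source; the derivatives `∂ₜV`, `∇ₓV` (which exist a.e., Rademacher) are
written with `deriv` / `gradient`. The constant `β` depends only on `(E, A, δ, T, r)`, uniformly in `b`, `V`, `λ`, `t̄` — the printed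
`β = β(δ, T, r, ‖b‖_∞)`. The proof (De Giorgi–Nash–Moser iteration with divergence-free drift) is not in the tree: NAMED FACT.

## References

* A. I. Nazarov, N. N. Ural'tseva, *The Harnack inequality and related properties for solutions of elliptic and parabolic equations with
  divergence-free lower-order coefficients*, Algebra i Analiz 23:1 (2011) 136–168; St. Petersburg Math. J. 23 (2012) 93–115;
  arXiv:1011.1888, §3 Cor. 3.2, Lemma 3.4, Cor. 3.3. [cite: NazarovUraltseva2011HarnackDivFree, Cor 3.2 (arXiv p.10)]
* Z. Lei, X. Ren, G. Tian, *A geometric characterization of potential Navier–Stokes singularities*, arXiv:2501.08976 (2025), Lemma 2.5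
  (p. 7). [cite: LeiRenTian2025, Lemma 2.5 (arXiv p.7)]
-/

noncomputable section

open MeasureTheory Set Function Metric

namespace Literature.Analysis.FluidPDE

section PositivityPropagation

variable (E : Type*) [NormedAddCommGroup E] [InnerProductSpace ℝ E] [FiniteDimensional ℝ E]
  [MeasurableSpace E] [BorelSpace E]

/-- **Nazarov–Ural'tseva propagation of positivity (Lei–Ren–Tian 2025, Lemma 2.5; Nazarov–Ural'tseva 2011, Cor. 3.2 / Lemma 3.4 /
Cor. 3.3).** Printed (LRT Lemma 2.5): "Suppose `V(x,t)` is a nonnegative Lipshitz supersolution in `B(1) × (0,T)` to the equation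
`∂ₜV − ΔV + b·∇V = 0` where the drift `b ∈ L^∞(B(1) × (0,T))` and `∇·b = 0`. Assume that `meas({x ∈ B(1) : V(x,t̄) ≥ λ}) ≥ δ` for
some `t̄ ∈ (0, T/3)`, `λ > 0` and `δ > 0`, then given any `0 < r < 1` there exists a constant `β = β(δ, T, r, ‖b‖_{L^∞}) > 0` such that
`V ≥ βλ` in `B(r) × (T/2, T)`." **Statement** (see the module docstring for the rendering): for `2 ≤ finrank E` and all `A ≥ 0`,
`δ > 0`, `T > 0`, `0 < r < 1` there is `β > 0` such that for every jointly measurable drift `b` with `‖b(t,x)‖ ≤ A` on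
`(0,T) × B(0,1)` and `∫∫ ⟪b, ∇ₓφ⟫ = 0` for all smooth `φ` compactly supported in the open cylinder, every `V : ℝ → E → ℝ` Lipschitz and
nonnegative on `(0,T) × B(0,1)` with `∫∫_{(0,T)×B(0,1)} (∂ₜV·η + ⟪∇ₓV, ∇ₓη⟫ + ⟪b, ∇ₓV⟫·η) ≥ 0` for every nonnegative Lipschitz `η`
vanishing for `‖x‖ ≥ ρ` and for `t ≤ τ` (some `ρ < 1`, `τ > 0`), every `λ > 0` and `t̄ ∈ (0, T/3)` with
`volume {x ∈ B(0,1) | λ ≤ V(t̄,x)} ≥ δ`: `β·λ ≤ V(t,x)` for all `t ∈ (T/2, T)`, `x ∈ B(0,r)`.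
[cite: NazarovUraltseva2011HarnackDivFree, Cor 3.2 (arXiv p.10)] [cite: LeiRenTian2025, Lemma 2.5 (arXiv p.7)] -/
def NazarovUraltseva2011_positivity_propagation : Prop :=
  2 ≤ Module.finrank ℝ E →
  ∀ ⦃A δ T r : ℝ⦄, 0 ≤ A → 0 < δ → 0 < T → 0 < r → r < 1 →
    ∃ β : ℝ, 0 < β ∧ ∀ ⦃b : ℝ → E → E⦄ ⦃V : ℝ → E → ℝ⦄ ⦃lam tbar : ℝ⦄,
      -- the drift: jointly measurable, bounded by `A` on the cylinder `(0,T) × B(0,1)` …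
      Measurable (uncurry b) → (∀ t ∈ Ioo 0 T, ∀ x ∈ ball (0 : E) 1, ‖b t x‖ ≤ A) →
      -- … and divergence free in the sense of distributions on the open cylinder
      (∀ φ : ℝ → E → ℝ, ContDiff ℝ (⊤ : ℕ∞) (uncurry φ) → HasCompactSupport (uncurry φ) →
        tsupport (uncurry φ) ⊆ Ioo 0 T ×ˢ ball (0 : E) 1 →
        ∫ p in Ioo 0 T ×ˢ ball (0 : E) 1, inner ℝ (b p.1 p.2) (gradient (φ p.1) p.2) = 0) →
      -- `V` is Lipschitz and nonnegative on the cylinder …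
      (∃ L, LipschitzOnWith L (uncurry V) (Ioo 0 T ×ˢ ball (0 : E) 1)) →
      (∀ t ∈ Ioo 0 T, ∀ x ∈ ball (0 : E) 1, 0 ≤ V t x) →
      -- … and a generalized supersolution of `∂ₜV − ΔV + b·∇V = 0`: for every nonnegative Lipschitz test function vanishing near the
      -- lateral boundary and near the bottom of the cylinder, `∫∫ (∂ₜV η + ⟪∇V, ∇η⟫ + ⟪b, ∇V⟫ η) ≥ 0`
      (∀ η : ℝ → E → ℝ, (∃ K, LipschitzWith K (uncurry η)) → (∀ t x, 0 ≤ η t x) →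
        (∃ ρ τ : ℝ, ρ < 1 ∧ 0 < τ ∧ ∀ t x, (ρ ≤ ‖x‖ ∨ t ≤ τ) → η t x = 0) →
        0 ≤ ∫ p in Ioo 0 T ×ˢ ball (0 : E) 1,
          (deriv (fun s => V s p.2) p.1 * η p.1 p.2 +
            inner ℝ (gradient (V p.1) p.2) (gradient (η p.1) p.2) +
            inner ℝ (b p.1 p.2) (gradient (V p.1) p.2) * η p.1 p.2)) →
      -- a level `λ > 0` occupied on a set of measure `≥ δ` at a time `t̄ ∈ (0, T/3)`
      0 < lam → tbar ∈ Ioo 0 (T / 3) →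
      ENNReal.ofReal δ ≤ volume {x ∈ ball (0 : E) 1 | lam ≤ V tbar x} →
      -- conclusion: `V ≥ βλ` on `(T/2, T) × B(0, r)`
      ∀ ⦃t : ℝ⦄ ⦃x : E⦄, t ∈ Ioo (T / 2) T → x ∈ ball (0 : E) r → β * lam ≤ V t x

end PositivityPropagation

end Literature.Analysis.FluidPDE

end
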